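import Summits.ResolutionOfSingularities.ResolutionOfSingularities.Theorems.HilbertSamuelEliminationSigmaMaxModificationsCorridor3WLadderIsoInsepSplitMilnorFinite
import HarnessLib

/-!
# [OURS · L1 W4.2] k2 row S-fin₂ — the PER-PRESENTATION form (res-L1-w42-idea-1 HANDOFF gen 9 «per-presentation S-fin₂ name»; tri-2 NOTE 14:17:15Z)
# (crux chain w42, cell k2 `T3insep` at `p = 2`; `--supports stmt-ResolutionOfSingularities-19249`)

OURS (cell res-hironaka, slot W4.2, seat res-D-pv-042); NOT a statement of [Hironaka2017] / [CossartJannsenSaito2020] / [Matsumura1987].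
AI-drafted, weaker than expert review. HELPER file, def-free: the proof of `splitMilnor_lt_top_of_isIsolated` (`…IsoInsepSplitMilnorFinite`,
p535430) run for a GIVEN 2-rank-one split presentation `Ô_{X,x} ≅ κ⟦x,y,z,w⟧/(x² + λy² + g)` instead of the infimum over all of them:
**`moduleFinite_milnorAlg_of_isIsolated`** — `X` locally of finite type over a field, `dim X ≤ N`, `x` isolated in `X_max(N)`, and ONE
presentation (`CharP κ 2`, `λ ∉ κ²`, `κ = κ² + λκ²`, `2 < ord g`, the completion iso) ⇒ `Module.Finite κ (MilnorAlg g)`, granted Nagata's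
criterion `Matsumura1987_30_10_hypersurface` (statement-only fact, p532117).  This is the form the image-ideal transfer row
`SliceIsoTransferJ₂` (res-L1-w42-idea-1 Sketch C10 r9.4 §5, tri-2 TRIAGE v10.4 (B)) consumes at 2-rank one
(`sliceJacobianPrimary_iff_finite_milnorAlg`).  Same chain as p535430 §2 (isolation `X → Spec 𝒪_{X,x} → Spec Ô → Spec κ⟦X⟧/(F)`, §1 «an isolated
double point has no other singular point», Nagata, `moduleFinite_milnorAlg_of_jacobian`); nothing new is claimed.
-/

noncomputable section

set_option linter.dupNamespace false

open scoped Classical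
open CategoryTheory AlgebraicGeometry TopologicalSpace IsLocalRing MvPowerSeries
open Literature.AlgebraicGeometry.Resolution Literature.RingTheory.HilbertSamuel
open Literature.AlgebraicGeometry.CossartJannsenSaito2020
open Summit.ResolutionOfSingularities.ResolutionOfSingularities.Theorems.CampaignW42
open Summit.ResolutionOfSingularities.ResolutionOfSingularities.Theorems.SigmaMaxModificationsCorridor3
open Summit.ResolutionOfSingularities.ResolutionOfSingularities.Theorems.SigmaMaxModificationsCorridor3.Moving

namespace Summit.ResolutionOfSingularities.ResolutionOfSingularities.Cruxes.SigmaMaxModifications.IdeasL1C6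

/-- **S-fin₂ per presentation.** For a scheme `X` locally of finite type over a field with `dim X ≤ N`, a point `x` ISOLATED in `X_max(N)`,
and a GIVEN 2-rank-one split presentation `Ô_{X,x} ≅ κ⟦x,y,z,w⟧/(x² + λy² + g)` (`char κ = 2`, `λ ∉ κ²`, `κ = κ² + λκ²`, `ord g > 2`): the
Milnor algebra `κ⟦z,w⟧/(g_z, g_w)` of THIS presentation is finite over `κ` — granted Nagata's Jacobian criterion (Matsumura Thm. 30.10,
statement-only fact).  (The infimum form `splitMilnor X x < ⊤` is `splitMilnor_lt_top_of_isIsolated`.) [OURS · L1 W4.2 · k2 S-fin₂] [folklore] -/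
theorem moduleFinite_milnorAlg_of_isIsolated (hJ : Matsumura1987_30_10_hypersurface.{0}) {k : Type} [Field k]
    {X : Scheme.{0}} (f : X ⟶ Spec (.of k)) [LocallyOfFiniteType f] [IsLocallyNoetherian X] {N : ℕ} {x : X}
    (hN : topologicalKrullDim X ≤ (N : WithBot ℕ∞)) (hiso : IsIsolatedInHSMaxLocus X N x)
    {κ : Type} [Field κ] [CharP κ 2] {lam : κ} {g : MvPowerSeries (Fin 2) κ} (hlam : ∀ a : κ, a ^ 2 ≠ lam)
    (hpb : ∀ c : κ, ∃ a b : κ, c = a ^ 2 + lam * b ^ 2) (hord : (2 : ℕ∞) < g.order)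
    (e : AdicCompletion (maximalIdeal (X.presheaf.stalk x)) (X.presheaf.stalk x) ≃+*
      (MvPowerSeries (Fin 4) κ ⧸ Ideal.span {splitEq 2 lam g})) :
    Module.Finite κ (MilnorAlg g) := by
  -- `g` has no constant and no linear terms
  have hg0 : constantCoeff g = 0 := by
    rw [← coeff_zero_eq_constantCoeff_apply]
    exact coeff_of_lt_order (lt_trans (by simp) hord)
  have hg1 : ∀ s : Fin 2, coeff (Finsupp.single s 1) g = 0 := fun s =>
    coeff_of_lt_order (lt_trans (by rw [Finsupp.degree_single]; norm_num) hord)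
  -- the regular local ring `S = κ⟦x,y,z,w⟧`, `F` of order exactly `2`
  set S := MvPowerSeries (Fin 4) κ with hS
  haveI : IsRegularLocalRing S := (isRegularLocalRing_mvPowerSeries_fin κ 4).1
  have hdimS : ringKrullDim S = (4 : ℕ) := (isRegularLocalRing_mvPowerSeries_fin κ 4).2
  set F := splitEq 2 lam g with hF
  obtain ⟨hF2, hF3⟩ := splitEq_mem_sq_not_mem_cube lam hord
  have hF0 : F ≠ 0 := by
    intro h0
    apply hF3
    rw [show splitEq 2 lam g = F from rfl, h0]
    exact zero_mem _
  have hF𝔪 : F ∈ maximalIdeal S := Ideal.pow_le_self two_ne_zero hF2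
  haveI : IsLocalRing (S ⧸ Ideal.span {F}) := IsoTailsHS.isLocalRing_quotient_span_singleton_of_mem hF𝔪
  -- the stalk `A = 𝒪_{X,x}`: excellent, `dim A ≤ N`, a quotient of a regular local ring, `Â ≅ S/(F)`
  set A := X.presheaf.stalk x with hA
  have hexc : IsExcellentRing A :=
    isExcellentRing_stalk_of_isExcellent (Scheme.isExcellent_of_locallyOfFiniteType Stacks07QW_field_holds f) x
  have hdimA : ringKrullDim A ≤ N := (ringKrullDim_stalk_le_topologicalKrullDim X x).trans hN
  obtain ⟨S₁, _, _, σ₁, hσ₁⟩ := TameWild.exists_regular_presentation_stalk f x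
  let e₁ : A ≃+* S₁ ⧸ RingHom.ker σ₁ := (RingHom.quotientKerEquivOfSurjective hσ₁).symm
  -- `dim A = 3 ≤ N`
  have h3N : 3 ≤ N := by
    haveI : IsNoetherianRing (AdicCompletion (maximalIdeal A) A) := isNoetherianRing_adicCompletion_maximalIdeal A
    have h1 : ringKrullDim (AdicCompletion (maximalIdeal A) A) = ringKrullDim (S ⧸ Ideal.span {F}) :=
      ringKrullDim_eq_of_ringEquiv e
    haveI : IsDomain S := isDomain_of_isRegularLocalRing S
    have h2 : ringKrullDim (S ⧸ Ideal.span {F}) + 1 = ringKrullDim S :=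
      ringKrullDim_quotient_span_singleton_succ_eq_ringKrullDim_of_mem_nonZeroDivisors
        (mem_nonZeroDivisors_of_ne_zero hF0) hF𝔪
    rw [ringKrullDim_adicCompletion] at h1
    have h4 : ringKrullDim A + 1 = ((4 : ℕ) : WithBot ℕ∞) := by rw [h1, h2, hdimS]
    have h5 : ringKrullDim A + 1 ≤ (N : WithBot ℕ∞) + 1 := add_le_add hdimA le_rfl
    rw [h4] at h5
    have : ((4 : ℕ) : WithBot ℕ∞) ≤ ((N + 1 : ℕ) : WithBot ℕ∞) := by push_cast; exact h5
    have : (4 : ℕ) ≤ N + 1 := by exact_mod_cast this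
    omega
  -- ISOLATION: `X` at `x` ⇒ `Spec 𝒪_{X,x}` ⇒ `Spec Ô` ⇒ `Spec S/(F)`
  have hsc : ∀ y : X, y ⤳ x → Scheme.hsFun X N y ≤ Scheme.hsFun X N x := fun y hy =>
    Scheme.hsFun_le_hsFun_of_specializes_over_field f N hy
  let T₀ : BlowupTower.{0} :=
    { X := fun _ => X, ln := fun _ => inferInstance, C := fun _ => ∅, isClosed_C := fun _ => isClosed_empty,
      π := fun _ => 𝟙 X, isBlowup := fun _ => isBlowup_id_vanishingIdeal_empty X }
  have hiso₁ : IsIsolatedInHSMaxLocus (Spec (X.presheaf.stalk x)) N (closedPoint (X.presheaf.stalk x)) :=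
    T₀.isIsolatedInHSMaxLocus_localize x N hsc hiso
  have hiso₂ : IsIsolatedInHSMaxLocus (Spec (CommRingCat.of (AdicCompletion (maximalIdeal A) A))) N
      (closedPoint (AdicCompletion (maximalIdeal A) A)) :=
    IdeasL1C4.isIsolatedInHSMaxLocus_adicCompletion_of_ringEquiv A hexc (RingHom.ker σ₁) e₁ N hdimA hiso₁
  haveI : IsNoetherianRing (AdicCompletion (maximalIdeal A) A) := isNoetherianRing_adicCompletion_maximalIdeal A
  haveI : IsNoetherianRing (S ⧸ Ideal.span {F}) := Ideal.Quotient.isNoetherianRing _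
  have hiso₃ : IsIsolatedInHSMaxLocus (Spec (CommRingCat.of (S ⧸ Ideal.span {F}))) N (closedPoint (S ⧸ Ideal.span {F})) :=
    isIsolatedInHSMaxLocus_spec_of_iso e.toCommRingCatIso N hiso₂
  -- §1 ⇒ regular at every non-maximal prime ∋ F; Nagata ⇒ the Jacobian row does not vanish there; the algebra half concludes
  refine moduleFinite_milnorAlg_of_jacobian hlam hpb hg0 hg1 fun P hP hPm hFP => ?_
  haveI := hP
  have hreg : IsRegularLocalRing (Localization.AtPrime P ⧸ (Ideal.span {F}).map (algebraMap S (Localization.AtPrime P))) :=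
    isRegularLocalRing_atPrime_quotient_of_isolated_doublePoint hdimS (by omega) hF2 hF3 hiso₃ P hFP hPm
  exact hJ 2 κ Nat.prime_two 4 F P hF0 hFP hreg

end Summit.ResolutionOfSingularities.ResolutionOfSingularities.Cruxes.SigmaMaxModifications.IdeasL1C6

end
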